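import Summits.QuantumFields.YangMills.Theorems.AllWindowsColdBoxBoxHighLineTiltTruncation
import Summits.QuantumFields.YangMills.Theorems.AllWindowsColdBoxBoxHighLineTiltCum3Split
import Summits.QuantumFields.YangMills.Theorems.AllWindowsColdBoxBoxHighLineSmallFieldMass
import Summits.QuantumFields.YangMills.Theorems.AllWindowsColdBoxBoxHighLinePlaqCostMomentsOnD

/-!
# U5 ε₂-glue (G2a), 13r-moments: the SINGLE-AVERAGE D-truncation transfer `E₀[1_D V]/E₀[1_D] ↔ E₀[V]` for L² observables

Free-hands helper of the κ-lineage (ym-line-fcl-p3 g27) for the ε₂-half of the NEXT rung U5 (`stub_landauThirdOrder`, LINE-20,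
⟨stmt-QuantumFields-24336⟩).  Planner ym-idea-2 g18's `Cruxes/BoxWindowHighSU2213/U5-BLOCKERS.md` §2 L2: «`f′(0) = κ₃,₀(c₀, c_T, U)` at the
Gaussian restricted to `D`; up to the D-truncation (exponentially small) it is a finite sum of CONNECTED pairings»; LEAD ym-line-sfw-p2 g78
(2026-08-29T22:50:14Z) and w3 g41 (22:35:16Z): the D-truncation transfer is NOT in their L2/L3 files.  This file is its first half, in the cell's
`gaussAvg` letters (`E₀ = gaussAvg β H`, `1_D = sfInd H s`, `D = smallField H s`, `μ_D := (volume.restrict D).withDensity (ofReal ∘ gaussWeight β H)`),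
with MOMENT (not sup) hypotheses so that POLYNOMIAL slots (`linCurvSq`, `quadVal M_H`, `Σ‖a‖²`, `cubicVertex`, the W₄-polynomial;
✓`integrable_polyCert_mul_gaussWeight`) are admissible next to bounded ones:

* §0 toolbox: `sfInd` idempotence and truncation on `D`; integrability of `V·gaussWeight` from `V²·gaussWeight`, and of `(XYZ)²·gaussWeight`,
  `(XY)²·gaussWeight`, `X²·gaussWeight` from the SIXTH moments `X⁶·w, Y⁶·w, Z⁶·w` (AM–GM `x²y²z² ≤ (x⁶+y⁶+z⁶)/3`);
* §1 ★ `abs_gaussAvg_one_sub_sfInd_mul_le` (`|E₀[(1−1_D)V]| ≤ √τ·√E₀[V²]` for `E₀[1−1_D] ≤ τ` — Cauchy–Schwarz ✓`abs_gaussAvg_mul_le_sqrt` with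
  `(1−1_D)² = 1−1_D`), ★ `abs_rD_sub_gaussAvg_le` (`|E₀[1_D V]/E₀[1_D] − E₀[V]| ≤ 2τ|E₀V| + 2√τ·√E₀[V²]`, `τ ≤ 1/2`), its size form
  `abs_rD_sub_gaussAvg_le_of_sq_le` (`≤ 4√τ·√A` for `E₀[V²] ≤ A`), `abs_rD_le` (`|E₀[1_D V]/E₀[1_D]| ≤ 2√E₀[V²]`), and the `hD`-dischargers
  `half_le_gaussAvg_sfInd`, `integral_sfInd_mul_gaussWeight_pos`.
The third-cumulant transfer built on these is `…RestrictionCum3.lean`.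

No definitions; standard axioms.  HONEST LABEL: helper-grade glue for U5 prep; U5, ⟨24004⟩, ⟨24336⟩ remain OPEN; route AllWindowsColdBox is DRAFT;
no crux, rung or summit is proved; the Yang–Mills mass gap is NOT proved by this file; no summit is proved by a line.
-/

set_option autoImplicit false

noncomputable section

open MeasureTheory Set

namespace Summit.QuantumFields.YangMills.Theorems.AllWindowsColdBoxBoxHighLine

namespace GaussRestrict

variable {H : ℕ} {β : ℝ}

/-! ## §0 Toolbox: `sfInd`, AM–GM domination, integrability from sixth moments -/

/-- `1_D · 1_D = 1_D`. -/
theorem sfInd_mul_sfInd (s : ℝ) (a : LandauFree H → E3) : sfInd H s a * sfInd H s a = sfInd H s a := by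
  unfold sfInd
  by_cases ha : a ∈ smallField H s
  · rw [Set.indicator_of_mem ha, mul_one]
  · rw [Set.indicator_of_notMem ha, mul_zero]

/-- `(1 − 1_D)·(1 − 1_D) = 1 − 1_D`. -/
theorem one_sub_sfInd_mul_self (s : ℝ) (a : LandauFree H → E3) : (1 - sfInd H s a) * (1 - sfInd H s a) = 1 - sfInd H s a := by
  have h := sfInd_mul_sfInd (H := H) s a
  ring_nf
  rw [sq, h]
  ring

/-- `|1 − 1_D| ≤ 1`. -/
theorem abs_one_sub_sfInd_le (s : ℝ) (a : LandauFree H → E3) : |1 - sfInd H s a| ≤ 1 := by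
  obtain ⟨h0, h1⟩ := TiltSup.sfInd_nonneg_le_one (H := H) s a
  rw [abs_le]; constructor <;> linarith

/-- `1_D · F` agrees with `1_D · G` as soon as `F = G` on `D`. -/
theorem sfInd_mul_congr_on {s : ℝ} {F G : (LandauFree H → E3) → ℝ} (h : ∀ a ∈ smallField H s, F a = G a) :
    (fun a => sfInd H s a * F a) = fun a => sfInd H s a * G a := by
  funext a
  unfold sfInd
  by_cases ha : a ∈ smallField H s
  · rw [Set.indicator_of_mem ha, h a ha]
  · rw [Set.indicator_of_notMem ha, zero_mul, zero_mul]

/-- On `D` the truncation `1_D·F` is `F`. -/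
theorem sfInd_mul_eq_on {s : ℝ} (F : (LandauFree H → E3) → ℝ) {a : LandauFree H → E3} (ha : a ∈ smallField H s) :
    sfInd H s a * F a = F a := by
  unfold sfInd; rw [Set.indicator_of_mem ha, one_mul]

/-- `μ_D`-a.e. the truncation `1_D·F` is `F`. -/
theorem ae_muD_eq_sfInd_mul (β s : ℝ) (F : (LandauFree H → E3) → ℝ) :
    F =ᵐ[((volume : Measure (LandauFree H → E3)).restrict (smallField H s)).withDensity fun a => ENNReal.ofReal (gaussWeight β H a)]
      fun a => sfInd H s a * F a := by
  filter_upwards [Tilt.ae_muD_mem_smallField H β s] with a ha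
  rw [sfInd_mul_eq_on F ha]

/-- AM–GM for three squares: `x²y²z² ≤ (x⁶ + y⁶ + z⁶)/3`. -/
theorem sq_mul_sq_mul_sq_le (x y z : ℝ) : x ^ 2 * y ^ 2 * z ^ 2 ≤ (x ^ 6 + y ^ 6 + z ^ 6) / 3 := by
  have ha : 0 ≤ x ^ 2 := sq_nonneg x
  have hb : 0 ≤ y ^ 2 := sq_nonneg y
  have hc : 0 ≤ z ^ 2 := sq_nonneg z
  set a := x ^ 2
  set b := y ^ 2
  set c := z ^ 2
  have e6x : x ^ 6 = a ^ 3 := by rw [show (6 : ℕ) = 2 * 3 from rfl, pow_mul]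
  have e6y : y ^ 6 = b ^ 3 := by rw [show (6 : ℕ) = 2 * 3 from rfl, pow_mul]
  have e6z : z ^ 6 = c ^ 3 := by rw [show (6 : ℕ) = 2 * 3 from rfl, pow_mul]
  rw [e6x, e6y, e6z]
  nlinarith [mul_nonneg ha (sq_nonneg (b - c)), mul_nonneg hb (sq_nonneg (a - c)), mul_nonneg hc (sq_nonneg (a - b)),
    mul_nonneg ha (sq_nonneg (a - b)), mul_nonneg ha (sq_nonneg (a - c)), mul_nonneg hb (sq_nonneg (a - b)),
    mul_nonneg hb (sq_nonneg (b - c)), mul_nonneg hc (sq_nonneg (a - c)), mul_nonneg hc (sq_nonneg (b - c)),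
    mul_nonneg (mul_nonneg ha hb) hc]

/-- `|v| ≤ (1 + v²)/2` (a private copy: the tree's public copies live in modules with disjoint import closure). -/
private theorem abs_le_half_one_add_sq (v : ℝ) : |v| ≤ (1 + v ^ 2) / 2 := by
  nlinarith [sq_nonneg (|v| - 1), sq_abs v, abs_nonneg v]

/-- `V·gaussWeight` is integrable once `V²·gaussWeight` is (`V` measurable, `β > 0`). -/
theorem integrable_mul_gaussWeight_of_sq (hβ : 0 < β) {V : (LandauFree H → E3) → ℝ} (hV : Measurable V)
    (hV2 : Integrable (fun a => V a ^ 2 * gaussWeight β H a)) : Integrable (fun a => V a * gaussWeight β H a) := by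
  have hG : Integrable (fun a : LandauFree H → E3 => (1 + V a ^ 2) / 2 * gaussWeight β H a) := by
    have h1 := EdgeChartGaussian.integrable_gaussWeight H hβ
    exact ((h1.add hV2).div_const 2).congr (Filter.Eventually.of_forall fun a => by simp only [Pi.add_apply]; ring)
  exact EdgeChartGaussian.integrable_mul_gaussWeight_of_abs_le H hβ hV hG fun a => abs_le_half_one_add_sq (V a)

/-- ★ **Integrability of the squared triple product from sixth moments**: `(XYZ)²·gaussWeight` is integrable once `X⁶·w`, `Y⁶·w`, `Z⁶·w` are. -/
theorem integrable_sq_mul3_mul_gaussWeight (hβ : 0 < β) {X Y Z : (LandauFree H → E3) → ℝ} (mX : Measurable X) (mY : Measurable Y)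
    (mZ : Measurable Z) (hX : Integrable (fun a => X a ^ 6 * gaussWeight β H a)) (hY : Integrable (fun a => Y a ^ 6 * gaussWeight β H a))
    (hZ : Integrable (fun a => Z a ^ 6 * gaussWeight β H a)) :
    Integrable (fun a => (X a * Y a * Z a) ^ 2 * gaussWeight β H a) := by
  have hG : Integrable (fun a : LandauFree H → E3 => (X a ^ 6 + Y a ^ 6 + Z a ^ 6) / 3 * gaussWeight β H a) :=
    (((hX.add hY).add hZ).div_const 3).congr (Filter.Eventually.of_forall fun a => by simp only [Pi.add_apply]; ring)
  refine EdgeChartGaussian.integrable_mul_gaussWeight_of_abs_le H hβ (((mX.mul mY).mul mZ).pow_const 2) hG fun a => ?_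
  rw [abs_of_nonneg (sq_nonneg _), show (X a * Y a * Z a) ^ 2 = X a ^ 2 * Y a ^ 2 * Z a ^ 2 by ring]
  exact sq_mul_sq_mul_sq_le (X a) (Y a) (Z a)

/-- `1⁶·gaussWeight` is integrable. -/
theorem integrable_one_pow_six_mul_gaussWeight (hβ : 0 < β) :
    Integrable (fun a : LandauFree H → E3 => (fun _ : LandauFree H → E3 => (1 : ℝ)) a ^ 6 * gaussWeight β H a) :=
  (EdgeChartGaussian.integrable_gaussWeight H hβ).congr (Filter.Eventually.of_forall fun a => by simp only [one_pow, one_mul])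

/-- Squared pair product from sixth moments. -/
theorem integrable_sq_mul2_mul_gaussWeight (hβ : 0 < β) {X Y : (LandauFree H → E3) → ℝ} (mX : Measurable X) (mY : Measurable Y)
    (hX : Integrable (fun a => X a ^ 6 * gaussWeight β H a)) (hY : Integrable (fun a => Y a ^ 6 * gaussWeight β H a)) :
    Integrable (fun a => (X a * Y a) ^ 2 * gaussWeight β H a) :=
  (integrable_sq_mul3_mul_gaussWeight hβ mX mY measurable_const hX hY (integrable_one_pow_six_mul_gaussWeight hβ)).congr
    (Filter.Eventually.of_forall fun a => by simp only [mul_one])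

/-- Square from the sixth moment. -/
theorem integrable_sq_mul_gaussWeight_of_six (hβ : 0 < β) {X : (LandauFree H → E3) → ℝ} (mX : Measurable X)
    (hX : Integrable (fun a => X a ^ 6 * gaussWeight β H a)) : Integrable (fun a => X a ^ 2 * gaussWeight β H a) :=
  (integrable_sq_mul3_mul_gaussWeight hβ mX measurable_const measurable_const hX (integrable_one_pow_six_mul_gaussWeight hβ)
    (integrable_one_pow_six_mul_gaussWeight hβ)).congr (Filter.Eventually.of_forall fun a => by simp only [mul_one])

/-! ## §1 The single-average transfer `E₀[1_D V]/E₀[1_D]` versus `E₀[V]` -/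

/-- ★ **The co-small-field tail of an L² observable**: `E₀[1 − 1_D] ≤ τ` ⇒ `|E₀[(1 − 1_D)·V]| ≤ √τ·√E₀[V²]`. -/
theorem abs_gaussAvg_one_sub_sfInd_mul_le (hβ : 0 < β) (s : ℝ) {τ : ℝ} (hτ : gaussAvg β H (fun a => 1 - sfInd H s a) ≤ τ)
    {V : (LandauFree H → E3) → ℝ} (hV : Measurable V) (hV2 : Integrable (fun a => V a ^ 2 * gaussWeight β H a)) :
    |gaussAvg β H (fun a => (1 - sfInd H s a) * V a)| ≤ Real.sqrt τ * Real.sqrt (gaussAvg β H (fun a => V a ^ 2)) := by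
  have hm : Measurable fun a : LandauFree H → E3 => 1 - sfInd H s a := measurable_const.sub (Tilt.measurable_sfInd H s)
  have hF2 : Integrable (fun a : LandauFree H → E3 => (1 - sfInd H s a) ^ 2 * gaussWeight β H a) :=
    Tilt.integrable_bdd_mul_gaussWeight H hβ (hm.pow_const 2) (C := 1) fun a => by
      rw [sq, one_sub_sfInd_mul_self]; exact abs_one_sub_sfInd_le s a
  have hV1 := integrable_mul_gaussWeight_of_sq hβ hV hV2
  have hFG : Integrable (fun a : LandauFree H → E3 => (1 - sfInd H s a) * V a * gaussWeight β H a) := by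
    have hG : Integrable (fun a : LandauFree H → E3 => (1 + V a ^ 2) / 2 * gaussWeight β H a) := by
      have h1 := EdgeChartGaussian.integrable_gaussWeight H hβ
      exact ((h1.add hV2).div_const 2).congr (Filter.Eventually.of_forall fun a => by simp only [Pi.add_apply]; ring)
    refine EdgeChartGaussian.integrable_mul_gaussWeight_of_abs_le H hβ (hm.mul hV) hG fun a => ?_
    rw [abs_mul]
    calc |1 - sfInd H s a| * |V a| ≤ 1 * |V a| := mul_le_mul_of_nonneg_right (abs_one_sub_sfInd_le s a) (abs_nonneg _)
      _ ≤ (1 + V a ^ 2) / 2 := by rw [one_mul]; exact abs_le_half_one_add_sq (V a)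
  have h := EdgeChartGaussian.abs_gaussAvg_mul_le_sqrt H hβ hF2 hV2 hFG
  have hsq : gaussAvg β H (fun a => (1 - sfInd H s a) ^ 2) = gaussAvg β H (fun a => 1 - sfInd H s a) := by
    congr 1; funext a; rw [sq, one_sub_sfInd_mul_self]
  rw [hsq] at h
  exact h.trans (mul_le_mul_of_nonneg_right (Real.sqrt_le_sqrt hτ) (Real.sqrt_nonneg _))

/-- `E₀[1_D V] = E₀[V] − E₀[(1 − 1_D)V]`. -/
theorem gaussAvg_sfInd_mul_eq_sub (hβ : 0 < β) (s : ℝ) {V : (LandauFree H → E3) → ℝ} (hV : Measurable V)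
    (hV2 : Integrable (fun a => V a ^ 2 * gaussWeight β H a)) :
    gaussAvg β H (fun a => sfInd H s a * V a) = gaussAvg β H V - gaussAvg β H (fun a => (1 - sfInd H s a) * V a) := by
  have hV1 := integrable_mul_gaussWeight_of_sq hβ hV hV2
  have hDV : Integrable (fun a : LandauFree H → E3 => sfInd H s a * V a * gaussWeight β H a) := by
    have hG : Integrable (fun a : LandauFree H → E3 => (1 + V a ^ 2) / 2 * gaussWeight β H a) := by
      have h1 := EdgeChartGaussian.integrable_gaussWeight H hβ
      exact ((h1.add hV2).div_const 2).congr (Filter.Eventually.of_forall fun a => by simp only [Pi.add_apply]; ring)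
    refine EdgeChartGaussian.integrable_mul_gaussWeight_of_abs_le H hβ ((Tilt.measurable_sfInd H s).mul hV) hG fun a => ?_
    obtain ⟨h0, h1⟩ := TiltSup.sfInd_nonneg_le_one (H := H) s a
    rw [abs_mul, abs_of_nonneg h0]
    calc sfInd H s a * |V a| ≤ 1 * |V a| := mul_le_mul_of_nonneg_right h1 (abs_nonneg _)
      _ ≤ (1 + V a ^ 2) / 2 := by rw [one_mul]; exact abs_le_half_one_add_sq (V a)
  have e : (fun a : LandauFree H → E3 => V a) = fun a => sfInd H s a * V a + (1 - sfInd H s a) * V a := by funext a; ring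
  have hcV : Integrable (fun a : LandauFree H → E3 => (1 - sfInd H s a) * V a * gaussWeight β H a) :=
    (hV1.sub hDV).congr (Filter.Eventually.of_forall fun a => by simp only [Pi.sub_apply]; ring)
  have h := EdgeChartGaussian.gaussAvg_add β H hDV hcV
  rw [← e] at h
  linarith

/-- `E₀[1_D] ≥ 1/2 > 0` under `E₀[1 − 1_D] ≤ τ ≤ 1/2`. -/
theorem half_le_gaussAvg_sfInd (hβ : 0 < β) (s : ℝ) {τ : ℝ} (hτ : gaussAvg β H (fun a => 1 - sfInd H s a) ≤ τ) (hτ2 : τ ≤ 1 / 2) :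
    1 / 2 ≤ gaussAvg β H (sfInd H s) := by
  rw [GaussTail.gaussAvg_sfInd_eq hβ s]; linarith

/-- `0 < ∫ 1_D·gaussWeight` under `E₀[1 − 1_D] ≤ τ ≤ 1/2` (the `hD` of the `μ_D`-lemmas). -/
theorem integral_sfInd_mul_gaussWeight_pos (hβ : 0 < β) (s : ℝ) {τ : ℝ} (hτ : gaussAvg β H (fun a => 1 - sfInd H s a) ≤ τ)
    (hτ2 : τ ≤ 1 / 2) : 0 < ∫ a, sfInd H s a * gaussWeight β H a := by
  have h := half_le_gaussAvg_sfInd hβ s hτ hτ2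
  have hZ := EdgeChartGaussian.integral_gaussWeight_pos H hβ
  unfold gaussAvg at h
  by_contra hneg
  have hneg' : (∫ a, sfInd H s a * gaussWeight β H a) ≤ 0 := not_lt.1 hneg
  have : (∫ a, sfInd H s a * gaussWeight β H a) / ∫ a, gaussWeight β H a ≤ 0 := div_nonpos_of_nonpos_of_nonneg hneg' hZ.le
  linarith

/-- `0 ≤ τ` (it dominates `E₀[1 − 1_D] ≥ 0`). -/
theorem tau_nonneg (hβ : 0 < β) (s : ℝ) {τ : ℝ} (hτ : gaussAvg β H (fun a => 1 - sfInd H s a) ≤ τ) : 0 ≤ τ :=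
  le_trans (EdgeChartGaussian.gaussAvg_nonneg H hβ fun a => by linarith [(TiltSup.sfInd_nonneg_le_one (H := H) s a).2]) hτ

/-- ★ **SINGLE-AVERAGE TRANSFER**: `E₀[1 − 1_D] ≤ τ ≤ 1/2`, `V` measurable with `V²·gaussWeight` integrable ⇒
`|E₀[1_D V]/E₀[1_D] − E₀[V]| ≤ 2τ·|E₀ V| + 2√τ·√E₀[V²]`. -/
theorem abs_rD_sub_gaussAvg_le (hβ : 0 < β) (s : ℝ) {τ : ℝ} (hτ : gaussAvg β H (fun a => 1 - sfInd H s a) ≤ τ) (hτ2 : τ ≤ 1 / 2)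
    {V : (LandauFree H → E3) → ℝ} (hV : Measurable V) (hV2 : Integrable (fun a => V a ^ 2 * gaussWeight β H a)) :
    |gaussAvg β H (fun a => sfInd H s a * V a) / gaussAvg β H (sfInd H s) - gaussAvg β H V| ≤
      2 * τ * |gaussAvg β H V| + 2 * Real.sqrt τ * Real.sqrt (gaussAvg β H (fun a => V a ^ 2)) := by
  have hp := half_le_gaussAvg_sfInd hβ s hτ hτ2
  have hp0 : 0 < gaussAvg β H (sfInd H s) := by linarith
  have htail := abs_gaussAvg_one_sub_sfInd_mul_le hβ s hτ hV hV2
  have hsplit := gaussAvg_sfInd_mul_eq_sub hβ s hV hV2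
  have hpe : gaussAvg β H (sfInd H s) = 1 - gaussAvg β H (fun a => 1 - sfInd H s a) := GaussTail.gaussAvg_sfInd_eq hβ s
  set p := gaussAvg β H (sfInd H s) with hpdef
  set τ' := gaussAvg β H (fun a => 1 - sfInd H s a) with hτ'def
  set e := gaussAvg β H V
  set c := gaussAvg β H (fun a => (1 - sfInd H s a) * V a)
  have hτ'0 : 0 ≤ τ' := tau_nonneg hβ s le_rfl
  have key : gaussAvg β H (fun a => sfInd H s a * V a) / p - e = (τ' * e - c) / p := by
    rw [hsplit, hpe]
    have : (1 : ℝ) - τ' ≠ 0 := by rw [← hpe]; exact hp0.ne'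
    field_simp
    ring
  rw [key, abs_div, abs_of_pos hp0, div_le_iff₀ hp0]
  have h1 : |τ' * e - c| ≤ τ' * |e| + |c| := by
    have := abs_sub (τ' * e) c
    rwa [abs_mul, abs_of_nonneg hτ'0] at this
  have h2 : τ' * |e| ≤ τ * |e| := mul_le_mul_of_nonneg_right hτ (abs_nonneg _)
  have hs0 : 0 ≤ Real.sqrt τ * Real.sqrt (gaussAvg β H (fun a => V a ^ 2)) := mul_nonneg (Real.sqrt_nonneg _) (Real.sqrt_nonneg _)
  have hτ0 : 0 ≤ τ := hτ'0.trans hτ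
  have hX : 0 ≤ 2 * τ * |e| + 2 * Real.sqrt τ * Real.sqrt (gaussAvg β H (fun a => V a ^ 2)) := by
    have := abs_nonneg e; positivity
  have hXp := mul_le_mul_of_nonneg_left hp hX
  linarith [h1, h2, htail, hXp]

/-- `|E₀ V| ≤ √E₀[V²]` (✓`abs_gaussAvg_le_sqrt`, integrability from the square). -/
theorem abs_gaussAvg_le_sqrt_sq (hβ : 0 < β) {V : (LandauFree H → E3) → ℝ} (hV : Measurable V)
    (hV2 : Integrable (fun a => V a ^ 2 * gaussWeight β H a)) :
    |gaussAvg β H V| ≤ Real.sqrt (gaussAvg β H (fun a => V a ^ 2)) :=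
  EdgeChartGaussian.abs_gaussAvg_le_sqrt H hβ hV2 (integrable_mul_gaussWeight_of_sq hβ hV hV2)

/-- ★ **SINGLE-AVERAGE TRANSFER, size form**: with `E₀[V²] ≤ A`, `|E₀[1_D V]/E₀[1_D] − E₀[V]| ≤ 4√τ·√A`. -/
theorem abs_rD_sub_gaussAvg_le_of_sq_le (hβ : 0 < β) (s : ℝ) {τ : ℝ} (hτ : gaussAvg β H (fun a => 1 - sfInd H s a) ≤ τ)
    (hτ2 : τ ≤ 1 / 2) {V : (LandauFree H → E3) → ℝ} (hV : Measurable V) (hV2 : Integrable (fun a => V a ^ 2 * gaussWeight β H a))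
    {A : ℝ} (hA : gaussAvg β H (fun a => V a ^ 2) ≤ A) :
    |gaussAvg β H (fun a => sfInd H s a * V a) / gaussAvg β H (sfInd H s) - gaussAvg β H V| ≤ 4 * Real.sqrt τ * Real.sqrt A := by
  have h := abs_rD_sub_gaussAvg_le hβ s hτ hτ2 hV hV2
  have he := abs_gaussAvg_le_sqrt_sq hβ hV hV2
  have hτ0 := tau_nonneg hβ s hτ
  have hsA : Real.sqrt (gaussAvg β H (fun a => V a ^ 2)) ≤ Real.sqrt A := Real.sqrt_le_sqrt hA
  have hτs : τ ≤ Real.sqrt τ := by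
    have h1 : Real.sqrt τ * Real.sqrt τ = τ := Real.mul_self_sqrt hτ0
    have h2 : Real.sqrt τ ≤ 1 := by rw [show (1 : ℝ) = Real.sqrt 1 from Real.sqrt_one.symm]; exact Real.sqrt_le_sqrt (by linarith)
    nlinarith [Real.sqrt_nonneg τ]
  have hS0 := Real.sqrt_nonneg (gaussAvg β H (fun a => V a ^ 2))
  nlinarith [Real.sqrt_nonneg τ, Real.sqrt_nonneg A, abs_nonneg (gaussAvg β H V), mul_le_mul hτs (he.trans hsA) (abs_nonneg _) (Real.sqrt_nonneg _),
    mul_le_mul_of_nonneg_left hsA (Real.sqrt_nonneg τ)]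

/-- **Size of a restricted average**: `|E₀[1_D V]/E₀[1_D]| ≤ 2·√E₀[V²]` (for `E₀[1_D] ≥ 1/2`). -/
theorem abs_rD_le (hβ : 0 < β) (s : ℝ) {τ : ℝ} (hτ : gaussAvg β H (fun a => 1 - sfInd H s a) ≤ τ) (hτ2 : τ ≤ 1 / 2)
    {V : (LandauFree H → E3) → ℝ} (hV : Measurable V) (hV2 : Integrable (fun a => V a ^ 2 * gaussWeight β H a)) :
    |gaussAvg β H (fun a => sfInd H s a * V a) / gaussAvg β H (sfInd H s)| ≤ 2 * Real.sqrt (gaussAvg β H (fun a => V a ^ 2)) := by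
  have hp := half_le_gaussAvg_sfInd hβ s hτ hτ2
  have hp0 : 0 < gaussAvg β H (sfInd H s) := by linarith
  -- Cauchy–Schwarz with `1_D² = 1_D ≤ 1`
  have hm := Tilt.measurable_sfInd H s
  have hF2 : Integrable (fun a : LandauFree H → E3 => sfInd H s a ^ 2 * gaussWeight β H a) :=
    Tilt.integrable_bdd_mul_gaussWeight H hβ (hm.pow_const 2) (C := 1) fun a => by
      obtain ⟨h0, h1⟩ := TiltSup.sfInd_nonneg_le_one (H := H) s a
      rw [sq, sfInd_mul_sfInd, abs_of_nonneg h0]; exact h1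
  have hFG : Integrable (fun a : LandauFree H → E3 => sfInd H s a * V a * gaussWeight β H a) := by
    have hG : Integrable (fun a : LandauFree H → E3 => (1 + V a ^ 2) / 2 * gaussWeight β H a) := by
      have h1 := EdgeChartGaussian.integrable_gaussWeight H hβ
      exact ((h1.add hV2).div_const 2).congr (Filter.Eventually.of_forall fun a => by simp only [Pi.add_apply]; ring)
    refine EdgeChartGaussian.integrable_mul_gaussWeight_of_abs_le H hβ (hm.mul hV) hG fun a => ?_
    obtain ⟨h0, h1⟩ := TiltSup.sfInd_nonneg_le_one (H := H) s a
    rw [abs_mul, abs_of_nonneg h0]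
    calc sfInd H s a * |V a| ≤ 1 * |V a| := mul_le_mul_of_nonneg_right h1 (abs_nonneg _)
      _ ≤ (1 + V a ^ 2) / 2 := by rw [one_mul]; exact abs_le_half_one_add_sq (V a)
  have h := EdgeChartGaussian.abs_gaussAvg_mul_le_sqrt H hβ hF2 hV2 hFG
  have hsq : gaussAvg β H (fun a => sfInd H s a ^ 2) = gaussAvg β H (sfInd H s) := by
    congr 1; funext a; rw [sq, sfInd_mul_sfInd]
  rw [hsq] at h
  have hp1 : Real.sqrt (gaussAvg β H (sfInd H s)) ≤ 1 := by
    rw [show (1 : ℝ) = Real.sqrt 1 from Real.sqrt_one.symm]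
    refine Real.sqrt_le_sqrt ?_
    have := GaussTail.gaussAvg_sfInd_eq (H := H) hβ s
    have h0 : 0 ≤ gaussAvg β H (fun a => 1 - sfInd H s a) := tau_nonneg hβ s le_rfl
    linarith
  have hnum : |gaussAvg β H (fun a => sfInd H s a * V a)| ≤ Real.sqrt (gaussAvg β H (fun a => V a ^ 2)) := by
    calc |gaussAvg β H (fun a => sfInd H s a * V a)| ≤ Real.sqrt (gaussAvg β H (sfInd H s)) * Real.sqrt (gaussAvg β H (fun a => V a ^ 2)) := h
      _ ≤ 1 * Real.sqrt (gaussAvg β H (fun a => V a ^ 2)) := mul_le_mul_of_nonneg_right hp1 (Real.sqrt_nonneg _)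
      _ = _ := one_mul _
  rw [abs_div, abs_of_pos hp0, div_le_iff₀ hp0]
  nlinarith [Real.sqrt_nonneg (gaussAvg β H (fun a => V a ^ 2)), hnum, hp]

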